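import Summits.HodgeConjecture.HodgeConjecture.Theorems.H413SpectrumPartsPin
import HarnessLib

/-!
# FLOOR-0 junction T7: COMPLETENESS — «all projections but one vanish ⇒ the class lies in THE discrete representation»

Cell hodgecm-mathlib, FLOOR 0; crux item H413 = stmt-HodgeConjecture-24833 (route `HCCMUnconditional`); prover F0P3-p04 (g0),
share «junction T7» (the step the S3 ∕ S4 folds of `Cruxes/H413/Lines/F0_U3CohMultOne.lean` take after letter E1′: F0P3-plan (g0)
2026-08-30T22:10:04Z «all projections but THE P vanish ⇒ the class lies in P»).  PROOF FILE: theorems only — no definition, no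
instance, no notation, no named fact, no `sorry`.  HONEST LABEL: HC_CM is proved only modulo the printed citations until rung 0 closes.

WHAT IS PROVED:
* §1 `mem_of_inner_eq_zero_of_ne` — for a UNITARY, DISCRETELY DECOMPOSABLE `π` (★ `ContRepresentation.IsDiscretelyDecomposable`:
  the irreducible closed subrepresentations span a dense subspace) with MULTIPLICITY ONE and an irreducible closed `P`: a vector
  orthogonal to every irreducible closed `W ≠ P` lies in `P` (`v − pr_P v` is orthogonal to `P`, to every other irreducible by ★
  `SpectrumJunction.isOrtho_of_ne`, hence to a dense subspace, hence `0`; [Dixmier1977, §5.4]);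
* §2 `mem_space_of_inner_eq_zero_of_ne` — the same for the discrete automorphic spectrum of any adelic group datum
  (`DiscreteAutomorphicRep`, ★ `AutomorphicSpectrum`);
* §3 AT THE PIN `U(V)`: `isDiscretelyDecomposable_rightRegular_pin` (`4 ≤ [F:ℚ]` ⇒ `Hm V` anisotropic ⇒ compact quotient ⇒
  `L² = L²_disc`, ★ `UnitaryGroup.isDiscretelyDecomposable_rightRegular_adelicGroupData`) and `mem_space_of_inner_eq_zero_of_ne_pin`
  (with letter E1 ★ `Rogawski1990.innerFormMultiplicityLeOne` BY NAME for multiplicity one, ★ `SpectrumJunction.hasMultiplicityOne_rightRegular_pin`).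

## References
* [Dixmier1977] J. Dixmier, *C*-algebras* (1977), §5.4.
* [BorelJacquet1979] A. Borel, H. Jacquet, PSPM 33.1 (1979), §4.6 (`L²_d` = Hilbert sum of irreducibles).
* [GelfandGraevPiatetskiShapiro1969] I. M. Gelfand, M. I. Graev, I. I. Piatetski-Shapiro (1969), Ch. 1 §2.3 (compact quotient).
* [Rogawski1990] J. Rogawski, Ann. of Math. Stud. 123 (1990), §14.6.
-/

set_option autoImplicit false

-- the mandated namespace has the single-problem summit's repeated segment (`HodgeConjecture.HodgeConjecture`)
set_option linter.dupNamespace false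

noncomputable section

namespace Summit.HodgeConjecture.HodgeConjecture.Cruxes.H413.SpectrumJunction

open MeasureTheory NumberField Topology
open scoped InnerProductSpace Matrix ComplexOrder
open Literature.NumberTheory.Automorphic Literature.NumberTheory.Automorphic.UnitaryGroup
open Summit.HodgeConjecture.HodgeConjecture.Cruxes.H413.CohFormsCarriers

/-! ## §1 Completeness: a vector orthogonal to every irreducible but `P` lies in `P` (discrete decomposability + multiplicity one) -/

section Completeness

variable {G H : Type*} [Group G] [NormedAddCommGroup H] [InnerProductSpace ℂ H] [CompleteSpace H]
  {π : ContRepresentation ℂ G H}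

/-- **«All projections but one vanish ⇒ the vector lies in THE subrepresentation.»**  For a unitary, DISCRETELY DECOMPOSABLE `π`
with MULTIPLICITY ONE and a topologically irreducible closed `P`: a vector `v` orthogonal to every irreducible closed `W ≠ P` lies in
`P`.  Proof: `v - pr_P v` is orthogonal to `P` and (by `isOrtho_of_ne`, `pr_P v ∈ P ⟂ W`) to every irreducible `W ≠ P`, hence to the
dense span of all irreducibles, hence `0`. [cite: Dixmier1977, §5.4] [cite: BorelJacquet1979, §4.6] -/
theorem mem_of_inner_eq_zero_of_ne (hπ : π.IsUnitary) (h1 : π.HasMultiplicityOne) (hdisc : π.IsDiscretelyDecomposable)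
    (P : ContRepresentation.ClosedSubrep π) (hP : P.toContRep.IsTopIrreducible) {v : H}
    (hv : ∀ W : ContRepresentation.ClosedSubrep π, W.toContRep.IsTopIrreducible → W ≠ P → ∀ u ∈ W, ⟪u, v⟫_ℂ = 0) :
    v ∈ P := by
  set q : H := v - P.toSubmodule.starProjection v with hq
  -- `q` is orthogonal to every irreducible closed subrepresentation
  have hqW : ∀ W : ContRepresentation.ClosedSubrep π, W.toContRep.IsTopIrreducible → ∀ u ∈ W, ⟪u, q⟫_ℂ = 0 := by
    intro W hW u hu
    by_cases hWP : W = P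
    · subst hWP
      exact Submodule.inner_right_of_mem_orthogonal hu (Submodule.sub_starProjection_mem_orthogonal v)
    · have h1' : ⟪u, P.toSubmodule.starProjection v⟫_ℂ = 0 :=
        (isOrtho_of_ne hπ h1 hW hP hWP).inner_eq hu (Submodule.starProjection_apply_mem _ v)
      rw [hq, inner_sub_right, hv W hW hWP u hu, h1', sub_zero]
  -- hence to the (dense) span of all of them
  set S : Set (ContRepresentation.ClosedSubrep π) := {W | W.toContRep.IsTopIrreducible} with hS
  set K : Submodule ℂ H := ⨆ W ∈ S, (W : ContRepresentation.ClosedSubrep π).toSubmodule with hK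
  have hKle : K ≤ (ℂ ∙ q)ᗮ := by
    refine iSup₂_le fun W hW u hu => ?_
    rw [Submodule.mem_orthogonal_singleton_iff_inner_left]
    exact hqW W hW u hu
  have hqK : q ∈ Kᗮ :=
    Submodule.orthogonal_le hKle (Submodule.le_orthogonal_orthogonal (ℂ ∙ q) (Submodule.mem_span_singleton_self q))
  have hKtop : K.topologicalClosure = ⊤ := by
    have h := congrArg (fun W : ContRepresentation.ClosedSubrep π => W.toSubmodule) hdisc
    rw [hK, hS]
    simpa [ContRepresentation.discretePart, ContRepresentation.ClosedSubrep.iSupClosure, Set.mem_setOf_eq] using h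
  have hKbot : Kᗮ = ⊥ := (Submodule.topologicalClosure_eq_top_iff).mp hKtop
  rw [hKbot, Submodule.mem_bot] at hqK
  have hv' : v = P.toSubmodule.starProjection v := sub_eq_zero.mp hqK
  rw [hv']
  exact Submodule.starProjection_apply_mem _ v

end Completeness

/-! ## §2 The same for the discrete automorphic spectrum of an adelic group datum -/

section DiscreteCompleteness

variable {K : Type} [Field K] [NumberField K] {𝒢 : AdelicGroupData.{0} K}
  {μ : Measure 𝒢.automorphicQuotient} [SMulInvariantMeasure 𝒢.Adelic 𝒢.automorphicQuotient μ]

/-- **An `L²`-class orthogonal to every discrete automorphic `P' ≠ P` lies in `P`** (regular representation discretely decomposable —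
e.g. compact quotient ★ `isDiscretelyDecomposable_rightRegular_of_locallyCompactSpace` — and of multiplicity one). This is the step
«after E1′ all projections but one vanish ⇒ the class of `ψ w` lies in THE `P`» of the S3 ∕ S4 folds. [cite: Dixmier1977, §5.4]
[cite: BorelJacquet1979, §4.6] -/
theorem mem_space_of_inner_eq_zero_of_ne (h1 : (𝒢.rightRegular μ).HasMultiplicityOne)
    (hdisc : (𝒢.rightRegular μ).IsDiscretelyDecomposable) (P : DiscreteAutomorphicRep 𝒢 μ) {v : 𝒢.L2 μ}
    (hv : ∀ P' : DiscreteAutomorphicRep 𝒢 μ, P' ≠ P → ∀ u ∈ P'.space, ⟪u, v⟫_ℂ = 0) : v ∈ P.space :=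
  mem_of_inner_eq_zero_of_ne (𝒢.isUnitary_rightRegular μ) h1 hdisc P.space P.irreducible
    fun W hW hne u hu => hv ⟨W, hW⟩ (fun h => hne (congrArg DiscreteAutomorphicRep.space h)) u hu

end DiscreteCompleteness

/-! ## §3 At the pin `U(V)` -/

section PinCompleteness

variable (F : HodgeCM.CMField) {ι₁ : F →+* ℂ} (V : HodgeCM.HermSpace3 F ι₁)

/-- **`L²(U(V)(F⁺)\U(V)(𝔸_{F⁺}), μ)` decomposes discretely** (`L² = L²_disc`): for `4 ≤ [F:ℚ]`, `Hm V` is positive definite at a complex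
place `≠` that of `ι₁`, hence anisotropic, so the quotient is compact and Gelfand–Graev–Piatetski-Shapiro applies (★
`UnitaryGroup.isDiscretelyDecomposable_rightRegular_adelicGroupData`). [cite: GelfandGraevPiatetskiShapiro1969, Ch. 1 §2.3]
[cite: BorelJacquet1979, §4.6] -/
theorem isDiscretelyDecomposable_rightRegular_pin (h4 : 4 ≤ Module.finrank ℚ F)
    (μ : Measure (adelicDatum F V).automorphicQuotient) [(adelicDatum F V).IsAutomorphicMeasure μ] :
    ((adelicDatum F V).rightRegular μ).IsDiscretelyDecomposable := by
  obtain ⟨τ, hτ⟩ := UnitaryGroup.exists_infinitePlace_ne (HodgeCM.CMField.K F) h4 ι₁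
  exact UnitaryGroup.isDiscretelyDecomposable_rightRegular_adelicGroupData (HodgeCM.CMField.K F) 3
    (HodgeCM.HermSpace3.Hm V)
    (UnitaryGroup.anisotropic_of_posDef_map (HodgeCM.CMField.K F) (HodgeCM.HermSpace3.Hm V) τ (V.posDef_of_ne τ hτ)) μ

/-- **AT THE PIN: an `L²`-class orthogonal to every discrete automorphic `P' ≠ P` of `U(V)` lies in `P`** (E1 by name for
multiplicity one; `4 ≤ [F:ℚ]` for discrete decomposability). [cite: Rogawski1990, §14.6 Thm. 14.6.4] [cite: Dixmier1977, §5.4] -/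
theorem mem_space_of_inner_eq_zero_of_ne_pin (hE1 : Literature.NumberTheory.Rogawski1990.innerFormMultiplicityLeOne)
    (h4 : 4 ≤ Module.finrank ℚ F) {μ : Measure (adelicDatum F V).automorphicQuotient} [(adelicDatum F V).IsAutomorphicMeasure μ]
    (P : DiscreteAutomorphicRep (adelicDatum F V) μ) {v : (adelicDatum F V).L2 μ}
    (hv : ∀ P' : DiscreteAutomorphicRep (adelicDatum F V) μ, P' ≠ P → ∀ u ∈ P'.space, ⟪u, v⟫_ℂ = 0) : v ∈ P.space :=
  mem_space_of_inner_eq_zero_of_ne (hasMultiplicityOne_rightRegular_pin F V hE1 h4 μ)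
    (isDiscretelyDecomposable_rightRegular_pin F V h4 μ) P hv

end PinCompleteness

end Summit.HodgeConjecture.HodgeConjecture.Cruxes.H413.SpectrumJunction

end
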